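import Summits.QuantumAdvantage.AdviceFreeQNC0.WindowCharacters
import Summits.QuantumAdvantage.AdviceFreeQNC0.JointResidueElimination
import Literature.Computability.MetaComplexity.LowDegreeComposition
import HarnessLib

/-!
# Cell qa-qnc0 (rung F-Q1, route RingFrame, crux α `RingToElim`): ring strategies supported on the
# two ends and ONE interior window are hard

The second unconditional special case of the crux α (`RingHardU` in walk coordinates), after
`EndSupportedStrategies.lean` (no interior position).  Let `n = L + L'` with both blocks long and
polynomially balanced (`log₂ n ≤ 2 log₂ min(L, L')`), `K ≤ (log₂ n)^C`, and let the walk strategy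
`y` (selectors of degree `≤ (log₂ n)^C`) select only positions in the left end `{g < K}`, the
interior window `[L, L + K)` and the right end `{g > n − K}`.  Then for every charge the ring game
is won on at most `(1 − η₁)·2ⁿ` inputs, `η₁ > 0` the constant of `jointElimHard`
(`ringWinU_oneWindow_le`).

Proof.  By `WindowCharacters.lean` the win bit is `N(u; X, Z) mod 2` where `X = |u_{<L}|`,
`Z = |u_{≥L}|` are the two block weights and `N(u; X', Z')` counts selected positions with
`A_g(u) + α_g X' + β_g Z' ≢ 0 (3)`, local data `A_g`, `(α_g, β_g) ∈ {(1,1),(2,1),(2,2)}`; the nine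
counts sum to `6·#selected`, so some residue pair `(X₀, Z₀)(u)` has an even count — a LOSING cell.
The first such cell (in the order `3X' + Z'`) is a function of the nine parity bits
`[N(u; X', Z') odd]`, each of degree `≤ D + K`; so the four decoder bits `[X₀ = 1], [X₀ = 2],
[Z₀ = 1], [Z₀ = 2]` have degree `≤ 9(D + K) ≤ (log₂ min(L, L'))^{2C+2}` (composition lemma,
`Smolensky.comp_mem_lowDeg_of_coord_mul`), and `jointElimHard` says the decoded cell IS the true
cell `(X, Z) mod 3` on `≥ η₁·2ⁿ` inputs — all of them losses.

The cell's statement (prover; a special case of crux α of route RingFrame); not in print.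
WHAT THIS IS NOT: strategies with two or more interior windows, or with unboundedly many selected
clusters (the compounding question of the crux), are untouched; the balance hypothesis excludes a
window adjacent to a block shorter than about `√n` (short blocks `≤ (log₂ n)^C` are covered by
`ringWinU_endSupported_le` after widening the end window); nothing on `LDMAPolylog`, `TRPlus` or α
in general; no separation.
-/

noncomputable section

namespace Summit.QuantumAdvantage.AdviceFreeQNC0

open Finset
open Literature.Computability.MetaComplexity Literature.Computability.MetaComplexity.Smolensky

variable {L L' : ℕ}

/-! ### Block weights of `w : {0,1}^{L+L'}` -/

/-- `W_g(x) = |x|` once `g` exceeds the length. [folklore] -/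
theorem wtPrefix_of_length_le (x : Fin L → Bool) {g : ℕ} (hg : L ≤ g) : wtPrefix x g = wt x := by
  unfold wtPrefix wt
  refine congrArg _ (Finset.filter_congr fun i _ => ?_)
  constructor
  · rintro ⟨-, h⟩; exact h
  · intro h; exact ⟨by omega, h⟩

/-- The weight of the first block of `w` is the prefix weight `W_L(w)`. [folklore] -/
theorem wt_left_eq_wtPrefix (w : Fin (L + L') → Bool) :
    wt (fun i : Fin L => w (Fin.castAdd L' i)) = wtPrefix w L := by
  conv_rhs => rw [← Fin.append_castAdd_natAdd (f := w)]
  rw [wtPrefix_append_of_le _ _ le_rfl, wtPrefix_of_length_le _ le_rfl]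

/-- The weight of the second block of `w` is `|w| − W_L(w)`. [folklore] -/
theorem wt_right_eq_sub (w : Fin (L + L') → Bool) :
    wt (fun j : Fin L' => w (Fin.natAdd L j)) = wt w - wtPrefix w L := by
  have h : wt w = wt (fun i : Fin L => w (Fin.castAdd L' i)) + wt (fun j : Fin L' => w (Fin.natAdd L j)) := by
    conv_lhs => rw [← Fin.append_castAdd_natAdd (f := w)]
    exact wt_append _ _
  rw [h, wt_left_eq_wtPrefix]
  omega

/-! ### Degree budget under polynomial balance -/

/-- `9·2·(log₂(L+L'))^C ≤ (log₂ min(L,L'))^{2C+2}` when `log₂(L+L') ≤ 2·log₂ min(L,L')` and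
`min(L, L') ≥ 32`. [folklore] -/
theorem degree_budget (C : ℕ) (hmin : 32 ≤ min L L') (hbal : Nat.log 2 (L + L') ≤ 2 * Nat.log 2 (min L L')) :
    18 * (Nat.log 2 (L + L')) ^ C ≤ (Nat.log 2 (min L L')) ^ (2 * C + 2) := by
  set m := Nat.log 2 (min L L') with hm
  have hm5 : 5 ≤ m := by
    have : Nat.log 2 32 ≤ m := Nat.log_mono_right hmin
    have h32 : Nat.log 2 32 = 5 := by
      rw [show (32 : ℕ) = 2 ^ 5 by norm_num, Nat.log_pow (by norm_num)]
    omega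
  calc 18 * (Nat.log 2 (L + L')) ^ C ≤ 18 * (2 * m) ^ C :=
        Nat.mul_le_mul_left _ (Nat.pow_le_pow_left hbal C)
    _ = 18 * (2 ^ C * m ^ C) := by rw [Nat.mul_pow]
    _ ≤ m ^ 2 * (m ^ C * m ^ C) := by
        have h1 : 18 ≤ m ^ 2 := by nlinarith
        have h2 : 2 ^ C ≤ m ^ C := Nat.pow_le_pow_left (by omega) C
        exact Nat.mul_le_mul h1 (Nat.mul_le_mul_right _ h2)
    _ = m ^ (2 * C + 2) := by rw [← pow_add, ← pow_add]; ring_nf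

/-! ### The one-window theorem -/

/-- **Ring strategies supported on the two ends and one interior window win on at most
`(1 − η₁)·2ⁿ` inputs.**  For every `C` and all large, polynomially balanced blocks `L, L'`
(`log₂(L+L') ≤ 2 log₂ min(L,L')`): if `K ≤ (log₂(L+L'))^C` and the walk strategy `y` (selectors
of degree `≤ (log₂(L+L'))^C`) vanishes at every position `g` with `K ≤ g`, `g ∉ [L, L+K)`,
`g + K ≤ L + L'`, then for every charge `c` the ring game in walk coordinates is won on at most
`θ·2^{L+L'}` inputs, `θ = 1 − η₁ < 1`.  A special case of crux α (`RingHardU`) of route RingFrame.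
(Cell statement; nine-cell parity obstruction + first-losing-cell decoder of degree
`≤ 9((log₂ n)^C + K)` + `jointElimHard`.) [cite: Srinivasan2023, Lemma 3.1] -/
theorem ringWinU_oneWindow_le :
    ∃ θ : ℝ, θ < 1 ∧ ∀ C : ℕ, ∃ L₀ : ℕ, ∀ L L' : ℕ, L₀ ≤ L → L₀ ≤ L' →
      Nat.log 2 (L + L') ≤ 2 * Nat.log 2 (min L L') →
      ∀ K : ℕ, K ≤ (Nat.log 2 (L + L')) ^ C → ∀ c : ℕ,
      ∀ y : Fin (L + L' + 1) → (Fin (L + L') → Bool) → Bool,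
        (∀ g, HasDeg (y g) ((Nat.log 2 (L + L')) ^ C)) →
        (∀ g : Fin (L + L' + 1), K ≤ g.val → (g.val < L ∨ L + K ≤ g.val) → g.val + K ≤ L + L' →
            ∀ u, y g u = false) →
          ((univ.filter fun u : Fin (L + L') → Bool => ringWinU c y u = true).card : ℝ) ≤
            θ * (2 : ℝ) ^ (L + L') := by
  classical
  obtain ⟨η₁, hη₁, hJ⟩ := jointElimHard
  refine ⟨1 - η₁, by linarith, fun C => ?_⟩
  obtain ⟨L₁, hL₁⟩ := hJ (2 * C + 2)
  refine ⟨max L₁ 32, fun L L' hL hL' hbal K hK c y hdeg hsupp => ?_⟩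
  have hL₁L : L₁ ≤ L := le_trans (le_max_left _ _) hL
  have hL₁L' : L₁ ≤ L' := le_trans (le_max_left _ _) hL'
  have hmin : 32 ≤ min L L' := le_min (le_trans (le_max_right _ _) hL) (le_trans (le_max_right _ _) hL')
  set D := (Nat.log 2 (L + L')) ^ C with hD
  -- local data of the characters (split point `L`, width `K`)
  let A : (Fin (L + L') → Bool) → Fin (L + L' + 1) → ℕ := fun u g =>
    if g.val < K then c + g.val + wtPrefix u g.val
    else if L ≤ g.val ∧ g.val < L + K then
      c + g.val + (univ.filter fun i : Fin (L + L') => L ≤ i.val ∧ i.val < g.val ∧ u i = true).card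
    else c + g.val + 2 * (univ.filter fun i : Fin (L + L') => g.val ≤ i.val ∧ u i = true).card
  let α : Fin (L + L' + 1) → ℕ := fun g => if g.val < K then 1 else 2
  let β : Fin (L + L' + 1) → ℕ := fun g =>
    if g.val < K then 1 else if L ≤ g.val ∧ g.val < L + K then 1 else 2
  have hβ : ∀ g : Fin (L + L' + 1), β g % 3 ≠ 0 := by
    intro g
    by_cases h1 : g.val < K
    · simp [β, h1]
    · by_cases h2 : L ≤ g.val ∧ g.val < L + K <;> simp [β, h1, h2]
  -- the hypothetical counts (Boolean form) and their parity bits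
  let N : (Fin (L + L') → Bool) → ℕ → ℕ → ℕ := fun u X' Z' =>
    ((univ : Finset (Fin (L + L' + 1))).filter fun g =>
      (y g u && decide ((A u g + α g * X' + β g * Z') % 3 ≠ 0)) = true).card
  let P : ℕ → ℕ → (Fin (L + L') → Bool) → Bool := fun X' Z' u => decide (N u X' Z' % 2 = 1)
  have hNprop : ∀ u X' Z', (univ.filter fun g : Fin (L + L' + 1) => y g u = true ∧
      ((if g.val < K then c + g.val + wtPrefix u g.val
        else if L ≤ g.val ∧ g.val < L + K then
          c + g.val + (univ.filter fun i : Fin (L + L') => L ≤ i.val ∧ i.val < g.val ∧ u i = true).card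
        else c + g.val + 2 * (univ.filter fun i : Fin (L + L') => g.val ≤ i.val ∧ u i = true).card) +
        (if g.val < K then 1 else 2) * X' +
        (if g.val < K then 1 else if L ≤ g.val ∧ g.val < L + K then 1 else 2) * Z') % 3 ≠ 0).card =
      N u X' Z' := by
    intro u X' Z'
    refine congrArg Finset.card ?_
    refine Finset.filter_congr fun g _ => ?_
    rw [Bool.and_eq_true, decide_eq_true_iff]
  -- (1) the win bit is `N(u; X, Z) mod 2`
  have hwin : ∀ u, ringWinU c y u = P (wtPrefix u L) (wt u - wtPrefix u L) u := by
    intro u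
    rw [ringWinU_eq_windowCount c K L y u, hNprop u (wtPrefix u L) (wt u - wtPrefix u L)]
  -- (2) `N` only depends on the residues
  have hNmod : ∀ u X' Z', N u X' Z' = N u (X' % 3) (Z' % 3) := by
    intro u X' Z'
    rw [← hNprop, ← hNprop]
    exact windowCount_mod c K L y u X' Z'
  -- (3) degree of the parity bits
  have hP : ∀ X' Z', HasDeg (P X' Z') (D + K) := fun X' Z' =>
    hasDeg_windowParity c K L y hdeg hsupp X' Z'
  -- (4) the nine-bit encoding and the first-losing-cell decoder
  let e : (Fin (L + L') → Bool) → (Fin 9 → Bool) := fun u k => P (k.val / 3) (k.val % 3) u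
  let sel : (Fin 9 → Bool) → ℕ := fun q =>
    if h : ∃ k : Fin 9, q k = false then (Fin.find (fun k => q k = false) h).val else 0
  have hsel_lt : ∀ q, sel q < 9 := by
    intro q
    by_cases h : ∃ k : Fin 9, q k = false
    · simp only [sel, dif_pos h]; exact Fin.isLt _
    · simp only [sel, dif_neg h]; norm_num
  have hsel_spec : ∀ q : Fin 9 → Bool, (∃ k, q k = false) → q ⟨sel q, hsel_lt q⟩ = false := by
    intro q h
    have hs : (⟨sel q, hsel_lt q⟩ : Fin 9) = Fin.find (fun k => q k = false) h := by
      apply Fin.ext; simp only [sel, dif_pos h]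
    rw [hs]
    exact Fin.find_spec h
  -- the four decoder bits as `𝔽₂`-polynomials, degree `≤ 9(D+K) ≤ (log₂ min)^(2C+2)`
  have he : ∀ k : Fin 9, (fun u => if e u k = true then (1 : ZMod 2) else 0) ∈
      lowDeg (ZMod 2) (L + L') (D + K) := fun k => hP _ _
  have hbudget : 9 * (D + K) ≤ (Nat.log 2 (min L L')) ^ (2 * C + 2) := by
    have := degree_budget C hmin hbal
    have hKD : K ≤ D := hK
    omega
  have hcomp : ∀ φ : (Fin 9 → Bool) → Bool,
      (fun u => if φ (e u) = true then (1 : ZMod 2) else 0) ∈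
        lowDeg (ZMod 2) (L + L') ((Nat.log 2 (min L L')) ^ (2 * C + 2)) := by
    intro φ
    have h := Smolensky.comp_mem_lowDeg_of_coord_mul (F := ZMod 2) e he (hasDeg_self φ)
    exact lowDeg_mono hbudget h
  let a₀ : CubeFn (ZMod 2) (L + L') := fun u => if decide (sel (e u) / 3 = 1) = true then 1 else 0
  let b₀ : CubeFn (ZMod 2) (L + L') := fun u => if decide (sel (e u) / 3 = 2) = true then 1 else 0
  let a₁ : CubeFn (ZMod 2) (L + L') := fun u => if decide (sel (e u) % 3 = 1) = true then 1 else 0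
  let b₁ : CubeFn (ZMod 2) (L + L') := fun u => if decide (sel (e u) % 3 = 2) = true then 1 else 0
  let dec : ZMod 2 → ZMod 2 → ℕ := fun p q => if p = 1 then 1 else if q = 1 then 2 else 0
  have hdec_val : ∀ t : ℕ, t < 3 →
      dec (if decide (t = 1) = true then 1 else 0) (if decide (t = 2) = true then 1 else 0) = t := by
    intro t ht
    interval_cases t <;> simp [dec]
  -- (5) `jointElimHard`
  have hJoint := hL₁ L L' hL₁L hL₁L' a₀ b₀ a₁ b₁
    (hcomp fun q => decide (sel q / 3 = 1)) (hcomp fun q => decide (sel q / 3 = 2))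
    (hcomp fun q => decide (sel q % 3 = 1)) (hcomp fun q => decide (sel q % 3 = 2)) dec dec
  -- (6) where both decoders are right, the strategy loses
  have hlose : (univ.filter fun w : Fin (L + L') → Bool =>
      dec (a₀ w) (b₀ w) % 3 = Hegedus.wt (fun i : Fin L => w (Fin.castAdd L' i)) % 3 ∧
      dec (a₁ w) (b₁ w) % 3 = Hegedus.wt (fun j : Fin L' => w (Fin.natAdd L j)) % 3) ⊆
      univ.filter fun w : Fin (L + L') → Bool => ¬ ringWinU c y w = true := by
    intro w hw
    rw [mem_filter] at hw
    obtain ⟨-, h0, h1⟩ := hw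
    rw [mem_filter]
    refine ⟨mem_univ _, ?_⟩
    -- the selected cell is a losing one
    have hsel0 : dec (a₀ w) (b₀ w) = sel (e w) / 3 := by
      have := hdec_val (sel (e w) / 3) (by have := hsel_lt (e w); omega)
      exact this
    have hsel1 : dec (a₁ w) (b₁ w) = sel (e w) % 3 := by
      have := hdec_val (sel (e w) % 3) (Nat.mod_lt _ (by norm_num))
      exact this
    have hex : ∃ k : Fin 9, e w k = false := by
      obtain ⟨X₀, Z₀, hX₀, hZ₀, heven⟩ := exists_windowCount_even
        ((univ : Finset (Fin (L + L' + 1))).filter fun g => y g w = true) (A w) α β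
        (fun g _ => hβ g)
      have hNN : (((univ : Finset (Fin (L + L' + 1))).filter fun g => y g w = true).filter
          fun g => (A w g + α g * X₀ + β g * Z₀) % 3 ≠ 0).card = N w X₀ Z₀ := by
        rw [Finset.filter_filter]; exact hNprop w X₀ Z₀
      rw [hNN] at heven
      refine ⟨⟨3 * X₀ + Z₀, by omega⟩, ?_⟩
      have hk1 : (3 * X₀ + Z₀) / 3 = X₀ := by omega
      have hk2 : (3 * X₀ + Z₀) % 3 = Z₀ := by omega
      show decide (N w ((3 * X₀ + Z₀) / 3) ((3 * X₀ + Z₀) % 3) % 2 = 1) = false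
      rw [hk1, hk2, decide_eq_false_iff_not]
      omega
    have hspec : decide (N w (sel (e w) / 3) (sel (e w) % 3) % 2 = 1) = false :=
      hsel_spec (e w) hex
    rw [decide_eq_false_iff_not] at hspec
    -- the true residues are the decoded ones
    have hX : Hegedus.wt (fun i : Fin L => w (Fin.castAdd L' i)) = wtPrefix w L :=
      wt_left_eq_wtPrefix w
    have hZ : Hegedus.wt (fun j : Fin L' => w (Fin.natAdd L j)) = wt w - wtPrefix w L :=
      wt_right_eq_sub w
    have hlt3 : sel (e w) / 3 < 3 := by have := hsel_lt (e w); omega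
    have h0' : sel (e w) / 3 = wtPrefix w L % 3 := by
      have h := h0
      rw [hsel0, hX, Nat.mod_eq_of_lt hlt3] at h
      exact h
    have h1' : sel (e w) % 3 = (wt w - wtPrefix w L) % 3 := by
      have h := h1
      rw [hsel1, hZ, Nat.mod_mod] at h
      exact h
    rw [hwin w]
    simp only [P, decide_eq_true_eq]
    rw [hNmod, ← h0', ← h1']
    exact hspec
  -- (7) count
  have hcount : ((univ.filter fun u : Fin (L + L') → Bool => ringWinU c y u = true).card : ℝ) +
      ((univ.filter fun u : Fin (L + L') → Bool => ¬ ringWinU c y u = true).card : ℝ) =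
        (2 : ℝ) ^ (L + L') := by
    have h := Finset.card_filter_add_card_filter_not (s := (univ : Finset (Fin (L + L') → Bool)))
      (fun u => ringWinU c y u = true)
    rw [Finset.card_univ, Fintype.card_fun, Fintype.card_bool, Fintype.card_fin] at h
    exact_mod_cast h
  have hge : η₁ * (2 : ℝ) ^ (L + L') ≤
      ((univ.filter fun u : Fin (L + L') → Bool => ¬ ringWinU c y u = true).card : ℝ) :=
    hJoint.trans (by exact_mod_cast Finset.card_le_card hlose)
  linarith

end Summit.QuantumAdvantage.AdviceFreeQNC0
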